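import Literature.NumberTheory.EllipticCurves.BurungaleSkinnerTianWan2024.GreenbergMainStatementOPEN
import Literature.NumberTheory.EllipticCurves.YanZhu2026.TwoVariableMainTheorems
import Literature.NumberTheory.EllipticCurves.HeegnerPoints
import HarnessLib

/-!
# Burungale–Skinner–Tian–Wan (arXiv:2409.01350v2, PREPRINT), §10.4.2 Thm. 10.10 (b) (label `IMC_ord`,
# p. 89): the TWO-VARIABLE main statements over an imaginary quadratic field `L` for a SEMISTABLE
# elliptic newform at an ordinary prime — statement 9.10 (label `St`, "standard `p`-adic
# `L`-functions, bis") and statement 9.12 (label `Greenberg`), case `· = ∅`, under (def)/(indef) —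
# plus the quadratic-twist clause, as explicitly labelled OPEN binders (claim-tagged; NEVER facts) over
# the tree's refereed Yan–Zhu 2026 two-variable carriers (`XOrd₂`/`𝓛_p^PR`, `XGr₂`/AnyRoot frame)

Written by the typer seat `bsd-littype-01` (gen 7) of the cross-ladder literature-typing layer
(D-0088(4); cell `run/shared/lean/pub/bsd-littype/`). D-0064: one file for the part of §10.4.2 that
gen 6's sibling `OrdinaryMainStatementSemistableOPEN.lean` (Thm. 10.10 (a) = the one-variable
cyclotomic statement 9.3 over `ℚ`, both clauses) left out: part (b). HONEST FRAMING: UNREFEREED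
preprint ⇒ explicitly labelled OPEN hypotheses only (`def … : Prop`, `[claim: …, status:
under-review]`), NEVER theorems, NEVER `[cite:]`-facts; nothing asserted about any curve; nothing
booked; no `_holds`. New notions WITH BODY (not facts): the inert part of the level
(`inertLevelPrimes`), hypothesis (ram) at a GIVEN prime (`RamAt`, the per-prime form of the tree's
`Rank1Residual.Ram`), the printed conditions (def)/(indef) of Thm. 10.5 (`DefiniteCondition`,
`IndefiniteCondition`) and the hypothesis block of Thm. 10.10 (b) (`Thm1010bHypotheses`, a structure of
hypotheses in the style of `YanZhu2026.GreenbergSetting`); FOUR OPEN binders; bookkeeping PROVED.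

## Printed statement (arXiv:2409.01350v2, p. 89 [litref page file p0089]; label `IMC_ord`, tex
## l.7519–7530)

"**Theorem 10.10.** Let `g ∈ S₂(Γ₀(N))` be an elliptic newform with `N` square-free and `p ∤ 2N` an
ordinary prime such that (irr_ℚ) holds. (a) Conj. 9.3 is true. (b) Let `L` be an imaginary quadratic
field satisfying `(D_L, 2N) = 1`, (2.15) and (irr_L). Suppose that either the condition (def) or
(indef) holds. Then Conj[.]s 9.10 and 9.12 are true. Moreover, the same holds for `g_K := g ⊗ χ_K`
for any quadratic field extension `K/ℚ` with `(D_K, Np) = 1`." Proof (p. 89, l.7528–7530): "One may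
proceed just as in the proof of Theorem 10.8." Remark 10.11 (l.7531–7533): "Part (a) gives a different
proof of a special case of Theorem 9.21 (c). In the (def) case part (b) is also a special case of a
result [SU, Thm. 3.30] of Skinner–Urban towards Conj. 9.10. In the remaining cases Theorem 10.10
presents new evidence towards Conj[.]s 9.10 and 9.12."

The conditions (Thm. 10.5, "An Eisenstein congruence divisibility", p. 87; label `KoMC'_lb`, tex l.7387–7396): "Write `N = N⁺N⁻` for `N⁺` precisely
divisible by split primes in `L`. (def) Each prime dividing `N⁻` satisfies (ram) and `ν(N⁻)` is odd,
(indef) Each prime dividing `N⁻ ≠ 1` satisfies (ram) and `ν(N⁻)` is even", with (ram) (p. 84, l.7184)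
"There exists a prime `ℓ ∥ N` with `ρ̄` ramified at `ℓ`" — read AT THE GIVEN PRIME `ℓ ∣ N⁻`; (2.15) =
(ord) "`p` splits in `L`: `(p) = v v̄` with `v` determined via `ι_p`" (l.1810); (irr_L) (l.1265) "`T̄` is
an absolutely irreducible `k_λ[G_L]`-module".

The two statements (p. 81): "**9.10** [label `St`, l.6918–6927]. Let `g ∈ S₂(Γ₀(N))` be an elliptic
newform, `p ∤ 2N` an ordinary or a supersingular prime, and `· ∈ {∅, cyc, ac}`. In the case `· = ac`
suppose that the root number of `E` over `L` equals `+1`. (a) `X^·_•(g_{/L})` is `Λ^·_{L,𝒪_λ}`-torsion.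
(b) We have an equality of ideals `(𝓛_p^{□,·}(g_{/L})) = ξ(X_•^·(g_{/L}))` in `Λ^·_{L,𝒪_λ} ⊗ ℚ_p` and
even in `Λ_L^·` if (irr_L) holds." (`□ = ∅`, `• = ord` for `g` ordinary, (9.8) l.6870.) "**9.12** [label
`Greenberg`, l.6935–6944]. Let `g ∈ S₂(Γ₀(N))` be an elliptic newform, `p ∤ N` a prime and
`· ∈ {∅, cyc, ac}`. In the case `· = ac` suppose that the root number of `E` over `L` equals `−1`. (a)
`X_Gr^·(g_{/L})` is `Λ^·_{L,𝒪_λ}`-torsion. (b) We have an equality of ideals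
`(𝓛_p^{Gr,·}(g_{/L})) = ξ(X_Gr^·(g_{/L}))` in `Λ^{ur,·}_{L,𝒪_λ} ⊗ ℚ_p` and even in `Λ_L^{ur,·}` for
`p ≠ 2`."

The objects (§9.1.2, p. 79; §5.5.1, p. 55; §5.3.3, p. 50): `X(g_{/L}) = X^∅_ord(g_{/L})`, the Pontryagin dual of the
ordinary Selmer group (label `ordL`, l.6717–6727: strict at `w ∤ p`, ordinary at both `w ∣ p`) over the
`ℤ_p²`-extension; `X_Gr(g_{/L})` (label `GrL`, l.6760: strict at the `ι_p`-prime `v`, NO condition at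
`v̄`); `𝓛_p(g_{/L}) := 𝓛_v(g/L) = 𝒞_v(loc_v 𝒵(g/L)) ∈ Λ_{L,𝒪_λ}` (l.4685–4691), "essentially the
specialization at `g_α` of the `p`-adic Rankin–Selberg `L`-function constructed by Hida" (Remark 5.6,
p. 46, l.3904–3909) in the INTEGRAL normalisation `𝒞^int = c̃_g · 𝒞`, `c̃_g = c_g` the congruence number
under (irr_ℚ) (l.4217–4222), with the interpolation of finite-order characters of `Γ_L` (§1.2.1 l.703–707;
on the cyclotomic line: ERL I′ = Thm. 5.10, p. 50, l.4249–4262, `Ω_g = ⟨g,g⟩/c̃_g`);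
`𝓛_p^Gr(g_{/L}) := 𝓛_v̄(loc_v̄ 𝒵(g/L)) ∈ Λ_{L,𝒪^ur_λ}` (p. 55, l.4704).

## What is typed here, and in which currency (E-instances `g = f_E`, `L = K`, `𝒪_λ = ℤ_p`)

Thm. 10.10 (b) asserts, for each of 9.10 / 9.12, the three cases `· ∈ {∅, cyc, ac}` (the `ac` cases
subject to the printed root-number provisos). THIS FILE TYPES THE TWO-VARIABLE CASE `· = ∅` OF BOTH
(the case the printed proof template — proof of Thm. 10.8, pp. 88–89, l.7496–7510 — establishes FIRST:
cyclotomic equality (Lemma 9.17) ⟹ two-variable equality by Thm. 10.5's divisibility + [SU, Lem. 3.2];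
the `cyc`/`ac` cases then follow "by descent"), and records the others precisely (below, NOT TYPED).

* 9.10 (`∅`, ordinary) ↦ EXACTLY the conclusion shape of the tree's REFEREED
  `YanZhu2026.thm42_XOrd₂_isTorsion_charIdeal_le_perrinRiou` (Yan–Zhu Thm. 4.2 (1) + (Im)): the
  `Λ₂ = IwasawaAlgebra₂ p`-module `X = (W.baseChange K).XOrd₂ p κ₁ κ₂ γ₁ γ₂` (reading flag
  `YZ-2VAR-ord-is-classical` of `TwoVariableSelmerDual.lean` — Remark 2.3 of Yan–Zhu: the ordinary
  condition at `w ∣ p` IS the classical one at good ordinary `p`, = BSTW's (9.4) `ordL` by the same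
  remark) is torsion, and for EVERY series `F` in Hida's type-I frame `IsHidaRankinLFunction ι W κ₁ κ₂
  π.f F` (Yan–Zhu Thm. 3.3 = [CGS25, Thm. 2.2.1]), with `𝓛 = perrinRiouLFunction W π F = 𝓛_p^PR(E/K)`:
  `Char(X) ⊂ (𝓛)` (`IdealLeSpan`) and `(𝓛) ⊂ Char(X)` (`SpanLeIdeal`) — the INTEGRAL equality (print:
  "even in `Λ_L` if (irr_L) holds", and (irr_L) is a hypothesis of 10.10 (b)). READING FLAG
  `BSTW-910-PR-normalisation` (cell reading, NOT a printed lemma of either paper): BSTW's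
  `𝓛_p(g_{/L}) = θ⁻¹(𝒞^int(loc_p 𝓑𝓕(g/L)))` is by their Remark 5.6 Hida's `p`-adic Rankin–Selberg
  function at `g_α`, i.e. the object of [CGS25, Thm. 2.2.1] = Yan–Zhu's `𝓛_p^I(f/K)`, in the
  normalisation `c_g · (1 − p α⁻²)(1 − α⁻²) · [J_g-valued 𝒞]` (l.3868–3874, l.4217–4222; on the
  cyclotomic line ERL I′ reads `𝓔(ζ) L(1,f⊗ψ_ζ⁻¹)L(1,f⊗χ_Lψ_ζ⁻¹)/(π²(−i)2³⟨g,g⟩/c_g)` against Yan–Zhu's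
  `W(ξ) p^{ord_p N𝔣/2} α^{−ord_p N𝔣} L(f/K,ξ⁻¹,1)/(8π²⟨f,f⟩) · (1 − p/α²)⁻¹(1 − 1/α²)⁻¹`), whereas
  `𝓛_p^PR = (1 − p/α²)(1 − 1/α²) · deg(π_E)/c_E² · 𝓛_p^I` (Yan–Zhu Def. 3.4); the two generate THE SAME
  IDEAL of `Λ_L` when `ord_p(c_g) = ord_p(deg π_E)` and `p ∤ c_E` — which holds here: `N` square-free
  and `p ∤ N`, so Agashe–Ribet–Stein Thm. 2.1 (tree fact `padicValNat_congruenceNumber_eq_of_not_sq_dvd`,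
  for the optimal `π_E`) and Mazur / Abbes–Ullmo (`p ∤ c_E` for `p ∤ N`; tree reading flag
  `BSTW-1111-lattice` of the gen-2 sibling) apply; root numbers, Gauss-sum quotients, `λ_N(g) = ±1`,
  `α`, `−i` are units. The identification of the two INTERPOLATION RANGES (BSTW print only the
  cyclotomic line and say "the general interpolation formula is more complicated to write and not
  necessary", l.3907–3909; Yan–Zhu pin `F` on the characters ramified at both `𝔭, 𝔭̄`, a Zariski-dense
  set) rests on Remark 5.6's sentence, not on a printed comparison — hence a FLAG, and the reason the
  binder is claim-tagged twice over (consumers wanting BSTW's own element must wait for a BF/Coleman-map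
  carrier: GAP row "zeta element over `L`" of the cell's census, unchanged).
* 9.12 (`∅`) ↦ EXACTLY the (Im)-clause conclusion shape of the tree's REFEREED
  `YanZhu2026.thm42_XGr₂_isTorsion_charIdeal_le_greenbergAnyRoot` (Yan–Zhu Thm. 4.2 (2) + (Im), over the
  gen-4 reduction-type-free value frame `IsGreenbergLFunctionAnyRoot₂` of the sibling
  `GreenbergMainStatementOPEN.lean`): `X_Gr = (W.baseChange K).XGr₂ p κ₁ κ₂ v̄ γ₁ γ₂` is `Λ₂`-torsion and,
  for EVERY Katz frame `LK` with period data and EVERY `G` in the frame at the inverse generators, and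
  every structure-compatible `J : ℤ_p → 𝒪_{ℂ_p}`: `char(X_Gr)𝒪_{ℂ_p}⟦T₁,T₂⟧ = (G)` (`Ideal.map (toUnr₂ p J)
  … = Ideal.span {G}`; `𝒪_{ℂ_p}⟦T₁⟧⟦T₂⟧ ⊇ Λ^ur` is the tree's receptacle for `Λ_L^ur` — WEAKER than print,
  as in every Greenberg-side statement of the tree). READING FLAG `BSTW-924-conjugate-convention`
  (= OPEN-QUESTIONS-01 Q21, verbatim the sibling 9.24 binder's): print's `X_Gr` is strict at the
  `ι_p`-prime `v` and `𝓛_p^Gr` is read at `v̄`; the Yan–Zhu / BCS / CGS currency is relaxed at the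
  `ι`-prime and unramified at `v̄`; the two families are exchanged by complex conjugation acting on
  `(L, v, Γ_L)` and the binder quantifies over ALL embedding data, so the typed family is the conjugate
  image of the printed family (cell-refereed identity, `bsd-ssimc` audit-1 addF / MEMO-8; not in print).
* Hypotheses (shared block `Thm1010bHypotheses W p N K`): `W` globally minimal of conductor `N`
  (`(N : ℤ) = W.conductorNorm ℤ`), `N` square-free ↦ `Semistable W`; `p ∤ 2N` ordinary ↦ `p ≠ 2`,
  `GoodOrd W p`; (irr_ℚ) ↦ `W.HasIrreducibleModPGaloisRep p`; `L = K` imaginary quadratic,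
  `(D_L, 2N) = 1` ↦ `IsCoprime (2N) (discr K)`; (ord) ↦ two primes of `K` over `p` (for 9.12 in addition
  `v ≠ v̄` over `p` with `v` induced by `ι`, the `compat` clause of every Katz statement of the tree, and
  `(κ₁, κ₂)` THE cyclotomic/anticyclotomic pair — the currency of the AnyRoot / Katz frames at
  `(γ₁⁻¹, γ₂⁻¹)`; for 9.10 ANY pair `(κ₁, κ₂)` with adapted generators describes `Λ_L`, as in Yan–Zhu
  Thm. 4.2 (1)); (irr_L) ↦ every `𝔽_p`-framing of `E[p]|_{G_K}` is absolutely irreducible (Yan–Zhu's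
  spelling); (def) ∨ (indef) ↦ `DefiniteCondition ∨ IndefiniteCondition` (N.B. the disjunction is
  EQUIVALENT to "`N⁻ ≠ 1` and (ram) at every prime of `N` inert in `L`" — PROVED,
  `definite_or_indefinite_iff` — the parity of `ν(N⁻)` only decides WHICH anticyclotomic statement
  applies: for `N` square-free and `(D_L, N) = 1` the root number of `E/L` is `−(−1)^{ν(N⁻)}`, so (def) ⟹
  `+1` (9.10-ac) and (indef) ⟹ `−1` (9.12-ac); not formalised — the tree has no `ε(E/L)`).
* Twist clauses ↦ as in every sibling: `W₀` the semistable curve carrying the hypotheses, `d ≠ 1`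
  square-free with every prime ramified in `ℚ(√d)` `≠ p` and `∤ N` (`RamifiedInQuadratic`), `W` a
  globally minimal model of `E₀^{(d)}` (`C • W = W₀.quadraticTwist d`), conclusion for `W` (with ITS
  parametrisation `π` / newform `f` at ITS conductor `N'`). (irr_L), (def)/(indef) are asked of `g`
  (print states the hypotheses for `g`; `N_{g_K} = N d_K²` is not square-free, so "(def) for `g_K`" does
  not parse — OPEN-QUESTIONS-01 §J records the reading).

NOT TYPED HERE (precisely; OPEN-QUESTIONS-01 §J and the gen-7 sheet carry the carrier census):
(i) 9.10-cyc for `g` = statement 9.8 (`cycBC`) = 9.3 for `g` AND `g ⊗ χ_L` by Lemma 9.17 (i) (p. 82,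
l.7020–7031) — both are Thm. 10.10 (a) + its twist clause (`(D_L, Np) = 1` holds), typed in the gen-6
sibling: no new content. (ii) 9.12-cyc: "`𝓛_p^{Gr,cyc}` does not interpolate classical `L`-values"
(Remark after 9.12 (ii)); no one-variable Greenberg-over-`L` carrier in the tree. (iii) 9.10-ac under
(def): the definite (Gross / Bertolini–Darmon) anticyclotomic statement for `N⁻` with `ν(N⁻)` odd —
Remark 10.11: "a special case of [SU, Thm. 3.30]"; carriers partly present
(`AnticyclotomicRankinSelbergPAdicLFunction.lean`, `BertoliniLongoVenerucci2026/`), to be sized by a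
successor. (iv) 9.12-ac under (indef): the BDP-type anticyclotomic statement on the Shimura-curve locus
`N⁻ ≠ 1`, `ν(N⁻)` even; the tree's BDP carriers are `X₀(N)`-Heegner only. (v) The `𝒪_λ ≠ ℤ_p`
generality; `Λ_L ⊗ ℚ_p`-versions (the hypotheses of 10.10 (b) include (irr_L) and `p ≠ 2`, so print's
conclusion IS integral).

RELATION TO REFEREED PRINT (located, for the pricing desks): Yan–Zhu 2026 Thm. 4.2 proves 9.10 (∅) /
9.12 (∅) for `E` at `p > 2` good ordinary under the HEEGNER HYPOTHESIS for `(N, L)` (+ absolute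
irreducibility, + (Im) for the equalities) — every prime of `N` SPLIT in `L`, i.e. `N⁻ = 1`; Thm. 10.10
(b) lives on the COMPLEMENTARY locus `N⁻ ≠ 1` (PROVED: `not_satisfiesHeegnerHypothesis_of_hypotheses`),
for `N` square-free, at every `p ≠ 2` incl. `p = 3`, without (Im). BCS25 Thm. 1.4.1 / 4.1.3 (`thm141_…`)
is the two-variable statement under (Heeg) as well. Skinner–Urban Thm. 3.30 covers the (def) case of
9.10 (Remark 10.11). So the NEW claims are: 9.10 (∅) under (indef), and 9.12 (∅) under (def)/(indef).

CONSUMERS: cell `bsd-ssimc` literal row D1 and the X9 / X11b lanes of `b2b-bsdres` (the (indef) locus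
IS the Shimura-curve locus `N⁻ ≠ 1` even of `ShimuraCurveHeegnerPointKolyvagin.lean`); `bsd-cn100`
(two-variable inputs of `p`-converse roads off the Heegner locus); ideation (OPEN-QUESTIONS-01 §J).

## References
* [BurungaleSkinnerTianWan2024] arXiv:2409.01350v2: Thm. 10.10 (p. 89; label `IMC_ord`, tex
  l.7519–7530), Rem. 10.11 (l.7531–7533); statements 9.10 (`St`, p. 81, l.6918–6927), 9.12 (`Greenberg`,
  p. 81, l.6935–6944); (def)/(indef) (Thm. 10.5, p. 87, l.7387–7396); (ram) (p. 84, l.7184); (ord) =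
  (2.15) (l.1810); (irr_L) (l.1265); §9.1.2 (p. 79; `ordL` l.6717, `GrL` l.6760); §5.5.1 (p. 55,
  l.4685–4705); Rem. 5.6 (p. 46; `ERLI-rmk`, l.3904–3909); §5.3.3 integral normalisations (p. 50,
  l.4216–4246); Thm. 5.10 = ERL I′ (p. 50, l.4249–4262); proof of Thm. 10.8 (pp. 88–89, l.7496–7510);
  Lemma 9.17 (`Eq'`, p. 82, l.7020–7031).
* [YanZhu2024MainConjNonCM] J. Algebra 693 (2026) = arXiv:2412.20078v4: Thm. 3.3, Def. 3.4, 4.1,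
  Thm. 4.2 — the carriers and the refereed neighbour (tree `YanZhu2026/TwoVariableMainTheorems.lean`,
  `GreenbergMainTheoremsAnyRoot.lean`).
* [AgasheRibetStein2012] Thm. 2.1 — tree fact `padicValNat_congruenceNumber_eq_of_not_sq_dvd` (the
  normalisation flag). [SkinnerUrban2014] Thm. 3.30 (Rem. 10.11). [CastellaGrossiSkinner2025] Thm. 2.2.1.
-/

noncomputable section

open scoped Classical

open PowerSeries NumberField IsDedekindDomain Field CongruenceSubgroup
  Literature.NumberTheory.GaloisRepresentations Literature.NumberTheory.EllipticCurves
  Literature.NumberTheory.EllipticCurves.ModularForms Literature.NumberTheory.EllipticCurves.Rank1Residual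

namespace Literature.NumberTheory.EllipticCurves.BurungaleSkinnerTianWan2024

open IwasawaAlgebra₂

/-! ### The conditions (def) / (indef) of Thm. 10.5 (p. 87) -/

/-- **The primes of the level inert in `L`** — the prime divisors of "`N⁻`" in "Write `N = N⁺N⁻` for
`N⁺` precisely divisible by split primes in `L`" (Thm. 10.5, p. 87): the primes `ℓ ∣ N` with exactly ONE
prime of `𝓞 K` above `ℓ`. Under the standing `(D_L, N) = 1` of 10.5 / 10.10 every `ℓ ∣ N` is unramified
in `L`, so "one prime above" = inert and the complement in the prime divisors of `N` is the split part
`N⁺`; for `N` square-free `N⁻ = ∏ inertLevelPrimes` and `ν(N⁻)` = its cardinality (the standing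
`(D_L, 2N) = 1`, (ord) of Thm. 10.5 / 10.8 / 10.10).
[cite: BurungaleSkinnerTianWan2024, Thm. 10.5 (p. 87; label KoMC'_lb, tex l.7387–7389: "N = N⁺N⁻ for N⁺ precisely divisible by split primes in L")] -/
def inertLevelPrimes (K : Type) [Field K] [NumberField K] (N : ℕ) : Set ℕ :=
  {ℓ | ℓ.Prime ∧ ℓ ∣ N ∧ ((Ideal.span {(ℓ : ℤ)}).primesOver (𝓞 K)).ncard = 1}

/-- **Hypothesis (ram) AT A GIVEN PRIME `ℓ`** (p. 84: "(ram) There exists a prime `ℓ ∥ N` with `ρ̄`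
ramified at `ℓ`", read at the prime `ℓ` named by (def)/(indef), Thm. 10.5: "Each prime dividing `N⁻`
satisfies (ram)"), for an elliptic curve in the tree's spelling of the sibling statements (`Rank1Residual.Ram`,
`skinner_urban_main_conj…`'s `haux`, Castella 2018 Thm. A): `ℓ ≠ p` is a prime of multiplicative
reduction of the globally minimal `W` (`ℓ ∥ N`) with `p ∤ ord_ℓ(Δ_min)` — by Tate's parametrisation
exactly "`E[p]` is ramified at `ℓ`". `Rank1Residual.Ram W p` is `∃ ℓ, RamAt W p ℓ` (`ram_of_ramAt`).
[cite: BurungaleSkinnerTianWan2024, (ram) (p. 84; tex l.7184) as used in (def)/(indef) (Thm. 10.5, p. 87, l.7390–7396)]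
[cite: SkinnerUrban2014, Thm. 2 (p. 3), second bullet (the spelling `p ∤ ord_ℓ(Δ)`)] -/
def RamAt (W : WeierstrassCurve ℚ) [W.IsGloballyMinimal] (p ℓ : ℕ) : Prop :=
  ∃ _ : Fact ℓ.Prime, ℓ ≠ p ∧ W.HasMultiplicativeReductionAtPrime ℓ ∧
    ¬ p ∣ padicValInt ℓ W.minimalDiscriminantInt

/-- **Condition (def)** (Thm. 10.5, p. 87; tex l.7390–7392): "Each prime dividing `N⁻` satisfies (ram)
and `ν(N⁻)` is odd" — every prime of `N` inert in `L` is a (ram)-prime, and their number is odd (for the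
square-free `N` of Thm. 10.5 / 10.10, `ν(N⁻) = #inertLevelPrimes`). The DEFINITE case: for `N` square-free
and `(D_L, N) = 1` the root number of `E` over `L` is `−(−1)^{ν(N⁻)} = +1` (not formalised).
[cite: BurungaleSkinnerTianWan2024, (def) (Thm. 10.5, p. 87; tex l.7390–7392)] -/
def DefiniteCondition (W : WeierstrassCurve ℚ) [W.IsGloballyMinimal] (p : ℕ) (K : Type) [Field K]
    [NumberField K] (N : ℕ) : Prop :=
  (∀ ℓ ∈ inertLevelPrimes K N, RamAt W p ℓ) ∧ Odd (inertLevelPrimes K N).ncard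

/-- **Condition (indef)** (Thm. 10.5, p. 87; tex l.7394–7396): "Each prime dividing `N⁻ ≠ 1` satisfies
(ram) and `ν(N⁻)` is even" — there IS a prime of `N` inert in `L`, every such prime is a (ram)-prime, and
their number is even. The INDEFINITE (Shimura-curve) case: root number of `E` over `L` equal to `−1`
(not formalised). [cite: BurungaleSkinnerTianWan2024, (indef) (Thm. 10.5, p. 87; tex l.7394–7396)] -/
def IndefiniteCondition (W : WeierstrassCurve ℚ) [W.IsGloballyMinimal] (p : ℕ) (K : Type) [Field K]
    [NumberField K] (N : ℕ) : Prop :=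
  (inertLevelPrimes K N).Nonempty ∧ (∀ ℓ ∈ inertLevelPrimes K N, RamAt W p ℓ) ∧
    Even (inertLevelPrimes K N).ncard

/-- **(def) or (indef) ⟺ `N⁻ ≠ 1` and (ram) at every prime of `N` inert in `L`** — the disjunction
assumed in Thm. 10.5 / 10.8 / 10.10 (b) forgets the parity of `ν(N⁻)` (which only selects the
anticyclotomic statement that applies). Pure logic (`ν` is odd or even; odd ⟹ non-zero ⟹ `N⁻ ≠ 1`).
[cite: BurungaleSkinnerTianWan2024, (def)/(indef) (Thm. 10.5, p. 87; tex l.7390–7396) (bookkeeping)] -/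
theorem definite_or_indefinite_iff (W : WeierstrassCurve ℚ) [W.IsGloballyMinimal] (p : ℕ) (K : Type)
    [Field K] [NumberField K] (N : ℕ) :
    (DefiniteCondition W p K N ∨ IndefiniteCondition W p K N) ↔
      ((inertLevelPrimes K N).Nonempty ∧ ∀ ℓ ∈ inertLevelPrimes K N, RamAt W p ℓ) := by
  constructor
  · rintro (⟨hram, hodd⟩ | ⟨hne, hram, -⟩)
    · refine ⟨Set.nonempty_of_ncard_ne_zero ?_, hram⟩
      rintro h0
      rw [h0] at hodd
      exact Nat.not_odd_zero hodd
    · exact ⟨hne, hram⟩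
  · rintro ⟨hne, hram⟩
    rcases Nat.even_or_odd (inertLevelPrimes K N).ncard with heven | hodd
    · exact Or.inr ⟨hne, hram, heven⟩
    · exact Or.inl ⟨hram, hodd⟩

/-- A (ram)-prime in the sense of `RamAt` witnesses the tree's `Rank1Residual.Ram W p` (the `∃`-form of
(ram) consumed by `skinner_urban_main_conj…`-type statements).
[cite: BurungaleSkinnerTianWan2024, (ram) (p. 84; tex l.7184) (bookkeeping)] -/
theorem ram_of_ramAt {W : WeierstrassCurve ℚ} [W.IsGloballyMinimal] {p ℓ : ℕ} [Fact p.Prime]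
    (h : RamAt W p ℓ) : Ram W p := by
  obtain ⟨hℓ, hne, hmult, hval⟩ := h
  exact ⟨ℓ, hℓ, hne, hmult, hval⟩

/-- Under (def) or (indef) hypothesis (ram) holds (some prime of `N` inert in `L` is a (ram)-prime) —
Thm. 10.10 (b)'s locus lies inside the (ram)-locus of Thm. 9.21 (c) / Skinner–Urban.
[cite: BurungaleSkinnerTianWan2024, (def)/(indef) (Thm. 10.5, p. 87; tex l.7390–7396) with (ram) (p. 84) (bookkeeping)] -/
theorem ram_of_definite_or_indefinite {W : WeierstrassCurve ℚ} [W.IsGloballyMinimal] {p : ℕ}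
    [Fact p.Prime] {K : Type} [Field K] [NumberField K] {N : ℕ}
    (h : DefiniteCondition W p K N ∨ IndefiniteCondition W p K N) : Ram W p := by
  obtain ⟨⟨ℓ, hℓ⟩, hram⟩ := (definite_or_indefinite_iff W p K N).mp h
  exact ram_of_ramAt (hram ℓ hℓ)

/-- Under (def) or (indef) the Heegner hypothesis for `(N, L)` FAILS (some prime of `N` has one prime of
`L` above it, not two): Thm. 10.10 (b) and the refereed Yan–Zhu 2026 Thm. 4.2 / BCS25 Thm. 1.4.1 (all
primes of `N` split in `L`) live on DISJOINT loci.
[cite: BurungaleSkinnerTianWan2024, (def)/(indef) (Thm. 10.5, p. 87; tex l.7387–7396) (bookkeeping)]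
[cite: GrossLMS1991, §1 (p. 235) (the Heegner hypothesis: all prime factors of N split)] -/
theorem not_satisfiesHeegnerHypothesis_of_definite_or_indefinite {W : WeierstrassCurve ℚ}
    [W.IsGloballyMinimal] {p : ℕ} {K : Type} [Field K] [NumberField K] {N : ℕ}
    (h : DefiniteCondition W p K N ∨ IndefiniteCondition W p K N) :
    ¬ SatisfiesHeegnerHypothesis N K := by
  obtain ⟨⟨ℓ, hℓprime, hℓN, hone⟩, -⟩ := (definite_or_indefinite_iff W p K N).mp h
  intro hHeeg
  have htwo := hHeeg ℓ hℓprime hℓN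
  omega

/-! ### The hypothesis block of Thm. 10.10 (b) (for `g = f_E`, `L = K`) -/

/-- **The hypotheses of Thm. 10.10 (b) for an elliptic curve**, field for field (module docstring,
"Hypotheses"): `W` a globally minimal model of `E/ℚ` of conductor `N` (`level`); "`N` square-free"
(`semistable`: good or multiplicative reduction everywhere, the tree's `Rank1Residual.Semistable`);
"`p ∤ 2N` an ordinary prime" (`two_ne`, `goodOrd` = good reduction and `p ∤ a_p`); "(irr_ℚ)" (`irrQ`);
"`L` an imaginary quadratic field" (`isImaginaryQuadratic`) "satisfying `(D_L, 2N) = 1`" (`coprime`),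
"(2.15)" = (ord) `p` splits in `L` (`split`: two primes of `𝓞 K` over `p`) "and (irr_L)" (`irrL`: every
`𝔽_p`-framing of `E[p]|_{G_K}` is absolutely irreducible — Yan–Zhu's spelling in the tree); "either the
condition (def) or (indef) holds" (`def_or_indef`). A structure OF HYPOTHESES (a `Prop`), asserting
nothing. [cite: BurungaleSkinnerTianWan2024, Thm. 10.10, preamble and (b) (p. 89; label IMC_ord, tex l.7519–7524)] -/
structure Thm1010bHypotheses (W : WeierstrassCurve ℚ) [W.IsGloballyMinimal] (p : ℕ) [Fact p.Prime]
    (N : ℕ) (K : Type) [Field K] [NumberField K] : Prop where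
  /-- `N` is the conductor of `E`. -/
  level : (N : ℤ) = W.conductorNorm ℤ
  /-- `N` is square-free: `E` is semistable. -/
  semistable : Semistable W
  /-- `p ∤ 2`. -/
  two_ne : p ≠ 2
  /-- `p ∤ N` is a prime of (good) ordinary reduction. -/
  goodOrd : GoodOrd W p
  /-- (irr_ℚ): `E[p]` is an irreducible `G_ℚ`-module. -/
  irrQ : W.HasIrreducibleModPGaloisRep p
  /-- `L = K` is imaginary quadratic. -/
  isImaginaryQuadratic : IsImaginaryQuadratic K
  /-- `(D_L, 2N) = 1`. -/
  coprime : IsCoprime (2 * (N : ℤ)) (NumberField.discr K)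
  /-- (2.15) = (ord): `p` splits in `L`. -/
  split : ((Ideal.span {(p : ℤ)}).primesOver (𝓞 K)).ncard = 2
  /-- (irr_L): `E[p]|_{G_L}` is absolutely irreducible (every framing). -/
  irrL : ∀ ρ : ModPGaloisRep K (ZMod p) 2, (W.baseChange K).IsTorsionGaloisRep p ρ →
    FramedRep.IsAbsolutelyIrreducible ρ
  /-- (def) or (indef). -/
  def_or_indef : DefiniteCondition W p K N ∨ IndefiniteCondition W p K N

/-- The hypotheses of Thm. 10.10 (b) put the curve in the (ram)-locus (`Rank1Residual.Ram W p`).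
[cite: BurungaleSkinnerTianWan2024, Thm. 10.10 (b) (p. 89) with (def)/(indef) (Thm. 10.5, p. 87) (bookkeeping)] -/
theorem Thm1010bHypotheses.ram {W : WeierstrassCurve ℚ} [W.IsGloballyMinimal] {p : ℕ} [Fact p.Prime]
    {N : ℕ} {K : Type} [Field K] [NumberField K] (h : Thm1010bHypotheses W p N K) : Ram W p :=
  ram_of_definite_or_indefinite h.def_or_indef

/-- The hypotheses of Thm. 10.10 (b) EXCLUDE the Heegner hypothesis for `(N, L)` (the locus of the
refereed Yan–Zhu 2026 Thm. 4.2). [cite: BurungaleSkinnerTianWan2024, Thm. 10.10 (b) (p. 89) with (def)/(indef) (Thm. 10.5, p. 87) (bookkeeping)] -/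
theorem Thm1010bHypotheses.not_satisfiesHeegnerHypothesis {W : WeierstrassCurve ℚ}
    [W.IsGloballyMinimal] {p : ℕ} [Fact p.Prime] {N : ℕ} {K : Type} [Field K] [NumberField K]
    (h : Thm1010bHypotheses W p N K) : ¬ SatisfiesHeegnerHypothesis N K :=
  not_satisfiesHeegnerHypothesis_of_definite_or_indefinite h.def_or_indef

/-! ### The OPEN binders: Thm. 10.10 (b), case `· = ∅` of 9.10 and of 9.12, and the twist clauses -/

/-- **OPEN HYPOTHESIS — UNREFEREED PREPRINT (arXiv:2409.01350v2), Thm. 10.10 (b), statement 9.10 in the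
TWO-VARIABLE case `· = ∅` (pp. 89, 81), for `g = f_E`.** Under `Thm1010bHypotheses W p N K` (`N`
square-free, `p ∤ 2N` ordinary, (irr_ℚ), `L` imaginary quadratic with `(D_L, 2N) = 1`, (ord), (irr_L),
(def) or (indef)): "`X(g_{/L})` is `Λ_{L,𝒪_λ}`-torsion [and] `(𝓛_p(g_{/L})) = ξ(X(g_{/L}))` … in `Λ_L`"
(integral: (irr_L) holds). Transcribed (module docstring): for ANY pair `(κ₁, κ₂)` of `ℤ_p`-extensions of
`K` with adapted generators `(γ₁, γ₂)` (so `Λ_L = IwasawaAlgebra₂ p`), `X = (W.baseChange K).XOrd₂ p κ₁ κ₂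
γ₁ γ₂` is torsion, and for every modular parametrisation `π` of `W` at level `N` and EVERY `F` in Hida's
type-I frame `IsHidaRankinLFunction ι W κ₁ κ₂ π.f F`, with `𝓛 = perrinRiouLFunction W π F`: `Char(X) ⊂ (𝓛)`
and `(𝓛) ⊂ Char(X)` — EXACTLY the conclusion shape of the refereed
`YanZhu2026.thm42_XOrd₂_isTorsion_charIdeal_le_perrinRiou` ((Im) clause), on the DISJOINT locus `N⁻ ≠ 1`.
READING FLAG `BSTW-910-PR-normalisation` (BSTW's `𝓛_p(g_{/L})`, Rem. 5.6 / §5.3.3 / §5.5.1, vs `𝓛_p^PR`: same ideal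
of `Λ_L` for square-free `N` — a cell reading, not a printed lemma). NEVER cite this `Prop` as a theorem
(no journal version, 2026-08-27); take it as an explicit hypothesis.
[claim: BurungaleSkinnerTianWan2024, status: under-review]
[cite: BurungaleSkinnerTianWan2024, Thm. 10.10 (b) (p. 89; label IMC_ord, tex l.7523–7524; ANNOUNCED, OPEN binder) with statement 9.10 (p. 81; label St, l.6918–6927), case · = ∅, and §5.5.1 (p. 55, l.4685–4691), Rem. 5.6 (p. 46, l.3904–3909)] -/
def thm1010b_standardMainStatement_twoVariable_OPEN : Prop :=
  ∀ {p : ℕ} [Fact p.Prime] (ι : integralClosure ℚ ℂ →+* ℂ_[p]) (W : WeierstrassCurve ℚ) [W.IsElliptic]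
    [W.IsGloballyMinimal] (K : Type) [Field K] [NumberField K] (κ₁ κ₂ : ZpExtension K p)
    (γ₁ γ₂ : absoluteGaloisGroup K) [Fact (ZpExtension.IsTopGeneratorPair κ₁ κ₂ γ₁ γ₂)]
    {N : ℕ} [NeZero N] (π : ModularParametrizationData W N),
    Thm1010bHypotheses W p N K →
    Module.IsTorsion (IwasawaAlgebra₂ p) ((W.baseChange K).XOrd₂ p κ₁ κ₂ γ₁ γ₂) ∧
      ∀ F : CycAntiSeries p, IsHidaRankinLFunction ι W κ₁ κ₂ π.f F →
        IdealLeSpan (WeierstrassCurve.XOrd₂.charIdeal (W.baseChange K) p κ₁ κ₂ γ₁ γ₂)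
            (perrinRiouLFunction W π F) ∧
          SpanLeIdeal (perrinRiouLFunction W π F)
            (WeierstrassCurve.XOrd₂.charIdeal (W.baseChange K) p κ₁ κ₂ γ₁ γ₂)

/-- **OPEN HYPOTHESIS — UNREFEREED PREPRINT (arXiv:2409.01350v2), Thm. 10.10 (b), statement 9.12 in the
TWO-VARIABLE case `· = ∅` (pp. 89, 81), for `g = f_E`.** Under `Thm1010bHypotheses W p N K`:
"`X_Gr(g_{/L})` is `Λ_{L,𝒪_λ}`-torsion [and] `(𝓛_p^Gr(g_{/L})) = ξ(X_Gr(g_{/L}))` … in `Λ_L^ur` for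
`p ≠ 2`". Transcribed (module docstring) in the currency of the sibling 9.24 binder: `(κ₁, κ₂)` THE
cyclotomic / anticyclotomic pair with generators `(γ₁, γ₂)`, `v ≠ v̄` the primes over `p` with `v` induced
by `ι`; `X_Gr = (W.baseChange K).XGr₂ p κ₁ κ₂ v̄ γ₁ γ₂` is torsion and for EVERY Katz frame `LK` with period
data, EVERY `G` in the reduction-type-free Greenberg frame `IsGreenbergLFunctionAnyRoot₂ … γ₁⁻¹ γ₂⁻¹ f …`
and every structure-compatible `J`: `char(X_Gr)𝒪_{ℂ_p}⟦T₁,T₂⟧ = (G)` — EXACTLY the (Im)-clause conclusion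
shape of the refereed `YanZhu2026.thm42_XGr₂_isTorsion_charIdeal_le_greenbergAnyRoot`, on the DISJOINT
locus `N⁻ ≠ 1`. READING FLAG `BSTW-924-conjugate-convention` (OPEN-QUESTIONS-01 Q21). NEVER cite this
`Prop` as a theorem; take it as an explicit hypothesis. [claim: BurungaleSkinnerTianWan2024, status: under-review]
[cite: BurungaleSkinnerTianWan2024, Thm. 10.10 (b) (p. 89; label IMC_ord, tex l.7523–7524; ANNOUNCED, OPEN binder) with statement 9.12 (p. 81; label Greenberg, l.6935–6944), case · = ∅, §9.1.2 (p. 79; GrL, l.6760) and §5.5.1 (p. 55, l.4704)] -/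
def thm1010b_greenbergMainStatement_twoVariable_OPEN : Prop :=
  ∀ {p : ℕ} [Fact p.Prime] (ι : PadicAlgCl p ≃+* ℂ) (W : WeierstrassCurve ℚ) [W.IsElliptic]
    [W.IsGloballyMinimal] (K : Type) [Field K] [NumberField K] (v vbar : HeightOneSpectrum (𝓞 K))
    (κ₁ κ₂ : ZpExtension K p) (γ₁ γ₂ : absoluteGaloisGroup K)
    [Fact (ZpExtension.IsTopGeneratorPair κ₁ κ₂ γ₁ γ₂)] {N : ℕ} [NeZero N] {f : CuspForm (Gamma0 N) 2}
    (_ : IsNewformOf W f) [NeZero (NumberField.discr K).natAbs],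
    Thm1010bHypotheses W p N K →
    -- (ord) with `v` the `ι`-prime: `p = v v̄`, `v ≠ v̄`
    ((p : ℕ) : 𝓞 K) ∈ v.asIdeal → ((p : ℕ) : 𝓞 K) ∈ vbar.asIdeal → vbar ≠ v →
    (∀ (w : InfinitePlace K) (k : 𝓞 K), k ∈ v.asIdeal ↔ ‖ι.symm (w.embedding (k : K))‖ < 1) →
    -- the `ℤ_p²`-tower: `κ₁` cyclotomic, `κ₂` anticyclotomic
    κ₁.IsCyclotomic → κ₂.IsAnticyclotomic →
    Module.IsTorsion (IwasawaAlgebra₂ p) ((W.baseChange K).XGr₂ p κ₁ κ₂ vbar γ₁ γ₂) ∧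
    -- every Katz frame with period data and every (reduction-type-free) Greenberg frame `G`
    ∀ (Ω δ : ℂ) (Ωp : (unrIntegers p)ˣ) (LK G : PowerSeries (PowerSeries (PadicComplexInt p))),
      Ω ≠ 0 → (δ ^ 2 = (NumberField.discr K : ℂ) ∨ δ ^ 2 = -(NumberField.discr K : ℂ)) →
      IsKatzMeasure₂ ι v vbar ∅ κ₁ κ₂ γ₁⁻¹ γ₂⁻¹ 1 Ω δ ((Ωp : unrIntegers p) : ℂ_[p]) LK →
      IsGreenbergLFunctionAnyRoot₂ ι v vbar κ₁ κ₂ γ₁⁻¹ γ₂⁻¹ f (NumberField.discr K).natAbs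
        (NumberField.classNumber K) LK G →
    ∀ J : ℤ_[p] →+* PadicComplexInt p,
      (∀ x : ℤ_[p], ((J x : PadicComplexInt p) : ℂ_[p]) = ((x : ℚ_[p]) : ℂ_[p])) →
      -- `(𝓛_p^Gr) = ξ(X_Gr) Λ^ur`, read in `𝒪_{ℂ_p}⟦T₁⟧⟦T₂⟧`
      (WeierstrassCurve.XGr₂.charIdeal (W.baseChange K) p κ₁ κ₂ vbar γ₁ γ₂).map (toUnr₂ p J) =
        Ideal.span {G}

/-- **OPEN HYPOTHESIS — UNREFEREED PREPRINT (arXiv:2409.01350v2), Thm. 10.10, QUADRATIC-TWIST clause of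
part (b), statement 9.10, case `· = ∅` (p. 89).** "Moreover, the same holds for `g_K := g ⊗ χ_K` for any
quadratic field extension `K/ℚ` with `(D_K, Np) = 1`." Transcribed (module docstring): hypotheses
`Thm1010bHypotheses W₀ p N₀ K` on the semistable curve `E₀` (model `W₀`, conductor `N₀`) and the
imaginary quadratic `L = K`; the twist by `ℚ(√d)`, `d ≠ 1` square-free, every prime ramified in `ℚ(√d)`
`≠ p` and `∤ N₀` (`RamifiedInQuadratic`); `W` a globally minimal model of `E₀^{(d)}`
(`C • W = W₀.quadraticTwist d`) with a modular parametrisation `π` at ITS conductor `N`; conclusion: the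
9.10 (`∅`) shape for `(W, π)` over `L`. NEVER cite this `Prop` as a theorem; take it as an explicit
hypothesis (its proof in print rests on Thm. 9.24's twist clause, "essentially the same argument
applies", p. 86 — OPEN-QUESTIONS-01 Q17). [claim: BurungaleSkinnerTianWan2024, status: under-review]
[cite: BurungaleSkinnerTianWan2024, Thm. 10.10, last sentence (p. 89; label IMC_ord, tex l.7525; ANNOUNCED, OPEN binder), part (b), statement 9.10 case · = ∅] -/
def thm1010b_twist_standardMainStatement_twoVariable_OPEN : Prop :=
  ∀ {p : ℕ} [Fact p.Prime] (ι : integralClosure ℚ ℂ →+* ℂ_[p]) (W₀ W : WeierstrassCurve ℚ)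
    [W₀.IsElliptic] [W₀.IsGloballyMinimal] [W.IsElliptic] [W.IsGloballyMinimal] (d : ℤ)
    (C : WeierstrassCurve.VariableChange ℚ) (K : Type) [Field K] [NumberField K]
    (κ₁ κ₂ : ZpExtension K p) (γ₁ γ₂ : absoluteGaloisGroup K)
    [Fact (ZpExtension.IsTopGeneratorPair κ₁ κ₂ γ₁ γ₂)] {N₀ N : ℕ} [NeZero N]
    (π : ModularParametrizationData W N),
    Thm1010bHypotheses W₀ p N₀ K →
    -- the twist `g_K = g ⊗ χ_{ℚ(√d)}`, `(D_{ℚ(√d)}, N₀ p) = 1`; `W` globally minimal for `E₀^{(d)}`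
    Squarefree d → d ≠ 1 → (∀ (q : ℕ) [Fact q.Prime], RamifiedInQuadratic d q → q ≠ p ∧ ¬ q ∣ N₀) →
    C • W = W₀.quadraticTwist (d : ℚ) → (N : ℤ) = W.conductorNorm ℤ →
    Module.IsTorsion (IwasawaAlgebra₂ p) ((W.baseChange K).XOrd₂ p κ₁ κ₂ γ₁ γ₂) ∧
      ∀ F : CycAntiSeries p, IsHidaRankinLFunction ι W κ₁ κ₂ π.f F →
        IdealLeSpan (WeierstrassCurve.XOrd₂.charIdeal (W.baseChange K) p κ₁ κ₂ γ₁ γ₂)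
            (perrinRiouLFunction W π F) ∧
          SpanLeIdeal (perrinRiouLFunction W π F)
            (WeierstrassCurve.XOrd₂.charIdeal (W.baseChange K) p κ₁ κ₂ γ₁ γ₂)

/-- **OPEN HYPOTHESIS — UNREFEREED PREPRINT (arXiv:2409.01350v2), Thm. 10.10, QUADRATIC-TWIST clause of
part (b), statement 9.12, case `· = ∅` (p. 89).** Transcribed as the previous binder (hypotheses on
`(E₀, N₀, p, L)`; the twist datum `d`, `C`, `W` globally minimal for `E₀^{(d)}`, `f` the newform of `W` at
its conductor `N`); conclusion: the 9.12 (`∅`) shape for `(W, f)` over `L` — `X_Gr(E₀^{(d)}/L_∞)` torsion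
and `char(X_Gr)𝒪_{ℂ_p}⟦T₁,T₂⟧ = (G')` for every reduction-type-free Greenberg frame `G'` of `f`. NEVER cite
this `Prop` as a theorem; take it as an explicit hypothesis (OPEN-QUESTIONS-01 Q17).
[claim: BurungaleSkinnerTianWan2024, status: under-review]
[cite: BurungaleSkinnerTianWan2024, Thm. 10.10, last sentence (p. 89; label IMC_ord, tex l.7525; ANNOUNCED, OPEN binder), part (b), statement 9.12 case · = ∅] -/
def thm1010b_twist_greenbergMainStatement_twoVariable_OPEN : Prop :=
  ∀ {p : ℕ} [Fact p.Prime] (ι : PadicAlgCl p ≃+* ℂ) (W₀ W : WeierstrassCurve ℚ) [W₀.IsElliptic]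
    [W₀.IsGloballyMinimal] [W.IsElliptic] [W.IsGloballyMinimal] (d : ℤ)
    (C : WeierstrassCurve.VariableChange ℚ) (K : Type) [Field K] [NumberField K]
    (v vbar : HeightOneSpectrum (𝓞 K)) (κ₁ κ₂ : ZpExtension K p) (γ₁ γ₂ : absoluteGaloisGroup K)
    [Fact (ZpExtension.IsTopGeneratorPair κ₁ κ₂ γ₁ γ₂)] {N₀ N : ℕ} [NeZero N]
    {f : CuspForm (Gamma0 N) 2} (_ : IsNewformOf W f) [NeZero (NumberField.discr K).natAbs],
    Thm1010bHypotheses W₀ p N₀ K →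
    Squarefree d → d ≠ 1 → (∀ (q : ℕ) [Fact q.Prime], RamifiedInQuadratic d q → q ≠ p ∧ ¬ q ∣ N₀) →
    C • W = W₀.quadraticTwist (d : ℚ) → (N : ℤ) = W.conductorNorm ℤ →
    ((p : ℕ) : 𝓞 K) ∈ v.asIdeal → ((p : ℕ) : 𝓞 K) ∈ vbar.asIdeal → vbar ≠ v →
    (∀ (w : InfinitePlace K) (k : 𝓞 K), k ∈ v.asIdeal ↔ ‖ι.symm (w.embedding (k : K))‖ < 1) →
    κ₁.IsCyclotomic → κ₂.IsAnticyclotomic →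
    Module.IsTorsion (IwasawaAlgebra₂ p) ((W.baseChange K).XGr₂ p κ₁ κ₂ vbar γ₁ γ₂) ∧
    ∀ (Ω δ : ℂ) (Ωp : (unrIntegers p)ˣ) (LK G' : PowerSeries (PowerSeries (PadicComplexInt p))),
      Ω ≠ 0 → (δ ^ 2 = (NumberField.discr K : ℂ) ∨ δ ^ 2 = -(NumberField.discr K : ℂ)) →
      IsKatzMeasure₂ ι v vbar ∅ κ₁ κ₂ γ₁⁻¹ γ₂⁻¹ 1 Ω δ ((Ωp : unrIntegers p) : ℂ_[p]) LK →
      IsGreenbergLFunctionAnyRoot₂ ι v vbar κ₁ κ₂ γ₁⁻¹ γ₂⁻¹ f (NumberField.discr K).natAbs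
        (NumberField.classNumber K) LK G' →
    ∀ J : ℤ_[p] →+* PadicComplexInt p,
      (∀ x : ℤ_[p], ((J x : PadicComplexInt p) : ℂ_[p]) = ((x : ℚ_[p]) : ℂ_[p])) →
      (WeierstrassCurve.XGr₂.charIdeal (W.baseChange K) p κ₁ κ₂ vbar γ₁ γ₂).map (toUnr₂ p J) =
        Ideal.span {G'}

/-! ### Bookkeeping (binder ⇒ shape), all CONDITIONAL on the OPEN binders; nothing is closed -/

section Bookkeeping

variable {p : ℕ} [Fact p.Prime] {K : Type} [Field K] [NumberField K]

/-- **Granted the 9.10 (`∅`) binder: statement 9.10 (b) in the form "`Char(X(E/L_∞))` is the principal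
ideal of `Λ_L` generated by an element mapping to `𝓛_p^PR(E/K)`"** — the form of the refereed
`YanZhu2026.charIdeal_eq_span_of_thm42_of_bigIm`, here WITHOUT (Im) and off the Heegner locus.
CONDITIONAL; closes nothing. [claim: BurungaleSkinnerTianWan2024, status: under-review]
[cite: BurungaleSkinnerTianWan2024, Thm. 10.10 (b) (p. 89) with statement 9.10 (b) (p. 81) (OPEN binder; bookkeeping)] -/
theorem exists_charIdealXOrd₂_eq_span_of_thm1010b_OPEN
    (hBSTW_OPEN : thm1010b_standardMainStatement_twoVariable_OPEN)
    (ι : integralClosure ℚ ℂ →+* ℂ_[p]) (W : WeierstrassCurve ℚ) [W.IsElliptic] [W.IsGloballyMinimal]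
    (κ₁ κ₂ : ZpExtension K p) (γ₁ γ₂ : absoluteGaloisGroup K)
    [Fact (ZpExtension.IsTopGeneratorPair κ₁ κ₂ γ₁ γ₂)] {N : ℕ} [NeZero N]
    (π : ModularParametrizationData W N) (hyp : Thm1010bHypotheses W p N K)
    {F : CycAntiSeries p} (hF : IsHidaRankinLFunction ι W κ₁ κ₂ π.f F) :
    ∃ g : IwasawaAlgebra₂ p, toCycAnti p g = perrinRiouLFunction W π F ∧
      WeierstrassCurve.XOrd₂.charIdeal (W.baseChange K) p κ₁ κ₂ γ₁ γ₂ = Ideal.span {g} := by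
  obtain ⟨-, hmc⟩ := hBSTW_OPEN ι W K κ₁ κ₂ γ₁ γ₂ π hyp
  obtain ⟨hle, hge⟩ := hmc F hF
  obtain ⟨g, -, hgL, hspan⟩ := hle.eq_span_of_spanLeIdeal hge
  exact ⟨g, hgL, hspan⟩

/-- **Granted the 9.10 (`∅`) binder: the `S⁻¹`-divisibility shape of Yan–Zhu Cor. 4.6
(`IdealLeSpanAwayFromPlus`, `S ⊂ Λ_K⁺`)** with the witness `s = 1`. CONDITIONAL; closes nothing.
[claim: BurungaleSkinnerTianWan2024, status: under-review]
[cite: BurungaleSkinnerTianWan2024, Thm. 10.10 (b) (p. 89) with statement 9.10 (b) (p. 81) (OPEN binder; bookkeeping)] -/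
theorem idealLeSpanAwayFromPlus_of_thm1010b_OPEN
    (hBSTW_OPEN : thm1010b_standardMainStatement_twoVariable_OPEN)
    (ι : integralClosure ℚ ℂ →+* ℂ_[p]) (W : WeierstrassCurve ℚ) [W.IsElliptic] [W.IsGloballyMinimal]
    (κ₁ κ₂ : ZpExtension K p) (γ₁ γ₂ : absoluteGaloisGroup K)
    [Fact (ZpExtension.IsTopGeneratorPair κ₁ κ₂ γ₁ γ₂)] {N : ℕ} [NeZero N]
    (π : ModularParametrizationData W N) (hyp : Thm1010bHypotheses W p N K)
    {F : CycAntiSeries p} (hF : IsHidaRankinLFunction ι W κ₁ κ₂ π.f F) :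
    IdealLeSpanAwayFromPlus (WeierstrassCurve.XOrd₂.charIdeal (W.baseChange K) p κ₁ κ₂ γ₁ γ₂)
      (perrinRiouLFunction W π F) :=
  ((hBSTW_OPEN ι W K κ₁ κ₂ γ₁ γ₂ π hyp).2 F hF).1.awayFromPlus

/-- **Granted the 9.12 (`∅`) binder: the LOCALISED divisibility shape of the sibling Thm. 9.24 binder
`thm924_greenberg_dvd_charIdealXGr₂_awayFromCyc_OPEN`** (`∃ s ≠ 0` in the cyclotomic variable with
`s · char(X_Gr)𝒪_{ℂ_p}⟦T₁,T₂⟧ ⊆ (G)`), with the witness `s = 1` (`exists_cyc_mul_le_of_le`) — for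
semistable `E` under (def)/(indef) instead of (spl). CONDITIONAL; closes nothing.
[claim: BurungaleSkinnerTianWan2024, status: under-review]
[cite: BurungaleSkinnerTianWan2024, Thm. 10.10 (b) (p. 89) with statement 9.12 (b) (p. 81) and Thm. 9.24 (pp. 85–86) (OPEN binder; bookkeeping)] -/
theorem exists_cyc_mul_charIdealXGr₂_le_of_thm1010b_OPEN
    (hBSTW_OPEN : thm1010b_greenbergMainStatement_twoVariable_OPEN)
    (ι : PadicAlgCl p ≃+* ℂ) (W : WeierstrassCurve ℚ) [W.IsElliptic] [W.IsGloballyMinimal]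
    (v vbar : HeightOneSpectrum (𝓞 K)) (κ₁ κ₂ : ZpExtension K p) (γ₁ γ₂ : absoluteGaloisGroup K)
    [Fact (ZpExtension.IsTopGeneratorPair κ₁ κ₂ γ₁ γ₂)] {N : ℕ} [NeZero N] {f : CuspForm (Gamma0 N) 2}
    (hf : IsNewformOf W f) [NeZero (NumberField.discr K).natAbs] (hyp : Thm1010bHypotheses W p N K)
    (hv : ((p : ℕ) : 𝓞 K) ∈ v.asIdeal) (hvbar : ((p : ℕ) : 𝓞 K) ∈ vbar.asIdeal) (hne : vbar ≠ v)
    (hcompat : ∀ (w : InfinitePlace K) (k : 𝓞 K), k ∈ v.asIdeal ↔ ‖ι.symm (w.embedding (k : K))‖ < 1)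
    (hκ₁ : κ₁.IsCyclotomic) (hκ₂ : κ₂.IsAnticyclotomic)
    {Ω δ : ℂ} {Ωp : (unrIntegers p)ˣ} {LK G : PowerSeries (PowerSeries (PadicComplexInt p))}
    (hΩ : Ω ≠ 0) (hδ : δ ^ 2 = (NumberField.discr K : ℂ) ∨ δ ^ 2 = -(NumberField.discr K : ℂ))
    (hLK : IsKatzMeasure₂ ι v vbar ∅ κ₁ κ₂ γ₁⁻¹ γ₂⁻¹ 1 Ω δ ((Ωp : unrIntegers p) : ℂ_[p]) LK)
    (hG : IsGreenbergLFunctionAnyRoot₂ ι v vbar κ₁ κ₂ γ₁⁻¹ γ₂⁻¹ f (NumberField.discr K).natAbs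
      (NumberField.classNumber K) LK G)
    {J : ℤ_[p] →+* PadicComplexInt p}
    (hJ : ∀ x : ℤ_[p], ((J x : PadicComplexInt p) : ℂ_[p]) = ((x : ℚ_[p]) : ℂ_[p])) :
    ∃ s : PowerSeries (PadicComplexInt p), s ≠ 0 ∧
      Ideal.span {PowerSeries.map (PowerSeries.C (R := PadicComplexInt p)) s} *
          (WeierstrassCurve.XGr₂.charIdeal (W.baseChange K) p κ₁ κ₂ vbar γ₁ γ₂).map (toUnr₂ p J) ≤
        Ideal.span {G} := by
  obtain ⟨-, hmc⟩ := hBSTW_OPEN ι W K v vbar κ₁ κ₂ γ₁ γ₂ hf hyp hv hvbar hne hcompat hκ₁ hκ₂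
  exact exists_cyc_mul_le_of_le (le_of_eq (hmc Ω δ Ωp LK G hΩ hδ hLK hG J hJ))

/-- **Granted the 9.12 (`∅`) binder: the torsion clause 9.12 (a)** for `X_Gr(E/L_∞)`.
CONDITIONAL; closes nothing. [claim: BurungaleSkinnerTianWan2024, status: under-review]
[cite: BurungaleSkinnerTianWan2024, Thm. 10.10 (b) (p. 89) with statement 9.12 (a) (p. 81) (OPEN binder; bookkeeping)] -/
theorem xGr₂_isTorsion_of_thm1010b_OPEN
    (hBSTW_OPEN : thm1010b_greenbergMainStatement_twoVariable_OPEN)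
    (ι : PadicAlgCl p ≃+* ℂ) (W : WeierstrassCurve ℚ) [W.IsElliptic] [W.IsGloballyMinimal]
    (v vbar : HeightOneSpectrum (𝓞 K)) (κ₁ κ₂ : ZpExtension K p) (γ₁ γ₂ : absoluteGaloisGroup K)
    [Fact (ZpExtension.IsTopGeneratorPair κ₁ κ₂ γ₁ γ₂)] {N : ℕ} [NeZero N] {f : CuspForm (Gamma0 N) 2}
    (hf : IsNewformOf W f) [NeZero (NumberField.discr K).natAbs] (hyp : Thm1010bHypotheses W p N K)
    (hv : ((p : ℕ) : 𝓞 K) ∈ v.asIdeal) (hvbar : ((p : ℕ) : 𝓞 K) ∈ vbar.asIdeal) (hne : vbar ≠ v)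
    (hcompat : ∀ (w : InfinitePlace K) (k : 𝓞 K), k ∈ v.asIdeal ↔ ‖ι.symm (w.embedding (k : K))‖ < 1)
    (hκ₁ : κ₁.IsCyclotomic) (hκ₂ : κ₂.IsAnticyclotomic) :
    Module.IsTorsion (IwasawaAlgebra₂ p) ((W.baseChange K).XGr₂ p κ₁ κ₂ vbar γ₁ γ₂) :=
  (hBSTW_OPEN ι W K v vbar κ₁ κ₂ γ₁ γ₂ hf hyp hv hvbar hne hcompat hκ₁ hκ₂).1

/-- **Granted the 9.10 (`∅`) binder: the torsion clause 9.10 (a)** for `X(E/L_∞)` (any adapted pair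
`(κ₁, κ₂)`; compare the refereed, hypothesis-light `YanZhu2026.cor29_XOrd₂_isTorsion`).
CONDITIONAL; closes nothing. [claim: BurungaleSkinnerTianWan2024, status: under-review]
[cite: BurungaleSkinnerTianWan2024, Thm. 10.10 (b) (p. 89) with statement 9.10 (a) (p. 81) (OPEN binder; bookkeeping)] -/
theorem xOrd₂_isTorsion_of_thm1010b_OPEN
    (hBSTW_OPEN : thm1010b_standardMainStatement_twoVariable_OPEN)
    (ι : integralClosure ℚ ℂ →+* ℂ_[p]) (W : WeierstrassCurve ℚ) [W.IsElliptic] [W.IsGloballyMinimal]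
    (κ₁ κ₂ : ZpExtension K p) (γ₁ γ₂ : absoluteGaloisGroup K)
    [Fact (ZpExtension.IsTopGeneratorPair κ₁ κ₂ γ₁ γ₂)] {N : ℕ} [NeZero N]
    (π : ModularParametrizationData W N) (hyp : Thm1010bHypotheses W p N K) :
    Module.IsTorsion (IwasawaAlgebra₂ p) ((W.baseChange K).XOrd₂ p κ₁ κ₂ γ₁ γ₂) :=
  (hBSTW_OPEN ι W K κ₁ κ₂ γ₁ γ₂ π hyp).1

end Bookkeeping

end Literature.NumberTheory.EllipticCurves.BurungaleSkinnerTianWan2024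

end
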